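import Summits.Ventures.PercRepro.S2CoreTwentySix

/-!
# PercRepro — THE CORANK-`≥ 26` CORE THEOREM AT LEVEL `5` AT RANK `22` (p7, gen 3; sub-claim S2)

S2CoreTwentySix's argument at `p = 22`: `#Y ≥ Σ_{s=20}^{21} C(n, s)` (`choose_sum_le_midCount_of_bound`, `B = 19`,
`B + 2 = 21 ≤ 22`), the sum key `2^{27}·2^{14}·C(n, 5) ≤ C(27, 22)·Σ_{s=20}^{21} C(n, s)` at `n₀ = 49` (room `1.30`,
decided; it FAILS at `n = 48 = p + 26`, so the corank `26` is a cell of the `p = 22` row) propagated to every `n ≥ 49` (`key_sum_of_base`), and the regime-II arithmetic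
`coreSharp_arith_II_of`; the clause is used at `n ≥ 49`. **`c025_core_five_nineteen_at_twentytwo`**. Axioms: standard.
-/

open scoped Matroid

namespace PercRepro

namespace ThmN

open Set

variable {α : Type}

/-- `Σ_{s ∈ [20, 21]} g s`, expanded. -/
theorem sum_Icc_twenty_twentyone (g : ℕ → ℕ) :
    ∑ s ∈ Finset.Icc 20 21, g s = g 20 + g 21 := by
  rw [show (21 : ℕ) = 20 + 1 from rfl, Finset.sum_Icc_succ_top (by norm_num),
    Finset.Icc_self,
    Finset.sum_singleton]

/-- The sum key at `p = 22`, `q = 5`, `B = 19`, `n₀ = 49`: one numeral, decided. -/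
theorem key_sum_twentyone_base :
    2 ^ (22 + 5) * 2 ^ (19 - 5) * (49).choose 5 ≤ (22 + 5).choose 22 * ∑ s ∈ Finset.Icc 20 21, (49).choose s := by
  rw [sum_Icc_twenty_twentyone]
  decide

/-- **The `e`-free core at level `5`, rank `22`, every corank `≥ 27`** (`f(5) ≤ 19`): `#Y ≥ Σ_{s=20}^{21} C(n, s)`
and the sum key from `n₀ = 49`. -/
theorem c025_core_five_nineteen_at_twentytwo (M : Matroid α) [M.Finite] (hbig : 22 + 26 < M.E.ncard)
    (hfree : ∀ e ∈ M.E, ∃ A ⊆ M.E \ {e}, e ∉ M.closure A ∧ e ∉ M.closure ((M.E \ {e}) \ A)) : RLS M 22 5 := by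
  classical
  set n := M.E.ncard with hn_def
  have hEcard : M.ground_finite.toFinset.card = n := by
    rw [hn_def, Set.ncard_eq_toFinset_card _ M.ground_finite]
  have hBq' : ∀ X ⊆ M.E, M.eRk X ≤ 5 → X.ncard ≤ 19 := fun X hX hr =>
    ncard_le_nineteen_of_eRk_le_five_of_free M hfree hX hr
  have hU : Matroid.topCount M 22 5 ≤ n.choose 5 * 2 ^ (19 - 5) := by
    calc Matroid.topCount M 22 5 ≤ Matroid.levelCount M 5 := Matroid.topCount_le_levelCount_bot 22 5
      _ = {X : Set α | X ⊆ M.E ∧ M.eRk X = 5}.ncard := rfl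
      _ ≤ n.choose 5 * 2 ^ (19 - 5) := by rw [← hEcard]; exact ncard_eRk_eq_le_choose_mul_of_bound M 5 19 hBq'
  have hΦ := phiK_le_two_pow_div 22 5
  have hU0 : (0 : ℚ) ≤ (Matroid.topCount M 22 5 : ℚ) := by positivity
  have hUq' : (Matroid.topCount M 22 5 : ℚ) ≤ (n.choose 5 : ℚ) * ((2 ^ (19 - 5) : ℕ) : ℚ) := by
    exact_mod_cast hU
  have hY := choose_sum_le_midCount_of_bound M hfree hBq' (show 19 + 2 ≤ 22 by norm_num)
  rw [hEcard] at hY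
  have key := key_sum_of_base 22 5 (2 ^ (19 - 5)) ((22 + 5).choose 22) 49 (Finset.Icc 20 21)
    (fun s hs => by rw [Finset.mem_Icc] at hs; omega) (by norm_num)
  have hkey := key key_sum_twentyone_base n (by omega)
  have hYq : ((∑ s ∈ Finset.Icc (19 + 1) (22 - 1), n.choose s : ℕ) : ℚ) ≤ (Matroid.midCount M 22 5 : ℚ) := by
    exact_mod_cast hY
  rw [RLS_iff]
  exact coreSharp_arith_II_of hΦ hU0 hUq' hkey hYq

end ThmN

end PercRepro
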